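import Literature.AlgebraicGeometry.Resolution.GaloisApproximationSplitting
import Literature.AlgebraicGeometry.Resolution.NormalModels
import Literature.AlgebraicGeometry.Resolution.KrullRamificationHenselRoots
import Mathlib.RingTheory.Localization.Integral
import HarnessLib

/-!
# [CoP1] Prop. 9.3, decomposition layer, in the frame: `R₁` lies dense in `R₁′`

Topic: `Literature/AlgebraicGeometry/Resolution`. PROOF side of `CossartPiltant2019ReductionP`
(`ArithmeticalThreefoldsLocal.lean`), input (C4), hypothesis `hDec` of
`cossartPiltant2019ReductionP_of_cjs_of_stableInertiaHensel`. This file instantiates the abstract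
density theorem (`GaloisApproximationSplitting.lean` + `SplittingRingUnramified.lean`, Abhyankar
1959 Thm. 1.47 and [CoP1] Prop. 6.2 (1)) in the currency of the frame: models `S[t] ⊆ E` and
their local rings `locAtCentre` at the centre of the valuation ring `O_E`.

* `exists_finset_dense_locAtCentre` — PROVED: for `N | M` finite Galois inside `E` there is a
  finite `c ⊆ O ∩ M` (the coefficients of the Galois-approximation polynomial) such that for
  every subfield `K′` with `M ≤ K′ ≤ Kˢ` (the decomposition field of `O_E ∩ N`), every NORMAL
  model `S[t₁] ⊆ O ∩ M` of `M` containing `c`, and its integral closure `S[t₁ ∪ t₁′]` in `K′`: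
  every element of `R₁′ := (S[t₁ ∪ t₁′])_𝔪` is congruent modulo `𝔪_{R₁′}ⁿ` to an element of
  `R₁ := (S[t₁])_𝔪`, for every `n` ("`R₁` lies dense in `R₁′` for the `m_{R₁′}`-adic topology",
  HAL p. 28).

Everything is PROVED; no named facts, definitions, instances or notation are introduced.

## Sources

* V. Cossart, O. Piltant, J. Algebra 320 (2008) 1051–1082: proof of Prop. 9.3, (44) and "`R₁`
  lies dense in `R₁′`" (HAL hal-00139124, pp. 27–28). [CossartPiltant2008]
* S. S. Abhyankar, Ann. of Math. Studies 43 (1959), Thm. 1.47. [Abhyankar1959]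
-/

noncomputable section

open IsLocalRing Polynomial IntermediateField
open scoped Pointwise

namespace Literature.AlgebraicGeometry.Resolution

universe u

/-- Elements of the subfield generated by `S` and `t` are fractions of elements of `S[t]`.
[folklore] -/
private theorem exists_div_eq_of_mem_closure₁ {S Ω : Type u} [CommRing S] [Field Ω] [Algebra S Ω]
    (t : Set Ω) {z : Ω} (hz : z ∈ Subfield.closure (Set.range (algebraMap S Ω) ∪ t)) :
    ∃ a b : Ω, a ∈ Algebra.adjoin S t ∧ b ∈ Algebra.adjoin S t ∧ b ≠ 0 ∧ z = a / b := by
  obtain ⟨y, hy, w, hw, hyw⟩ := Subfield.mem_closure_iff.mp hz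
  rw [← Algebra.adjoin_eq_ring_closure] at hy hw
  by_cases hw0 : w = 0
  · refine ⟨0, 1, zero_mem _, one_mem _, one_ne_zero, ?_⟩
    rw [← hyw, hw0, div_zero, zero_div]
  · exact ⟨y, w, hy, hw, hw0, hyw.symm⟩

set_option maxHeartbeats 400000 in
/-- **[CoP1] Prop. 9.3, decomposition layer: "`R₁` lies dense in `R₁′`" in the frame.** See the
module docstring. The finite set `c` consists of the coefficients of the characteristic
polynomial of a weak-approximation element separating `O_E ∩ N` from its conjugates
(`exists_monic_aeval_eq_zero_coeff_mem`); a normal model containing `c` has the valuation's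
decomposition group as the stabilizer of its centre (`stabilizer_le_stabilizer_of_coeff_mem_range`),
and the local ring of the integral closure in `K′ ⊆ Kˢ` is a localization of the `Gal(N|K′)`-fixed
subring of the integral closure in `N`, to which `surjective_quotient_maximalIdeal_pow_comp_of_stabilizer_le`
applies. [cite: CossartPiltant2008, proof of Prop. 9.3 (HAL pp. 27–28)] [cite: Abhyankar1959, Thm. 1.47] -/
theorem exists_finset_dense_locAtCentre
    (S : Type u) [CommRing S] [IsNoetherianRing S]
    (E : Type u) [Field E] [Algebra S E]
    (OE : ValuationSubring E)
    (M : Subfield E) (hSM : ∀ s : S, algebraMap S E s ∈ M)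
    (N : IntermediateField M E) [FiniteDimensional M N] [IsGalois M N] :
    ∃ c : Finset E, (c : Set E) ⊆ (M : Set E) ∧ (∀ x ∈ c, x ∈ OE) ∧
      ∀ (K' : Subfield E), M ≤ K' → K' ≤ N.toSubfield →
        K' ≤ (lift (fixedField (decompositionGroupIn OE N))).toSubfield →
      ∀ (t₁ : Finset E), (t₁ : Set E) ⊆ M →
        M ≤ Subfield.closure (Set.range (algebraMap S E) ∪ (t₁ : Set E)) →
        (Algebra.adjoin S (t₁ : Set E)).toSubring ≤ OE.toSubring →
        (∀ x : E, x ∈ M → IsIntegral (Algebra.adjoin S (t₁ : Set E)) x →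
          x ∈ Algebra.adjoin S (t₁ : Set E)) →
        (c : Set E) ⊆ Algebra.adjoin S (t₁ : Set E) →
      ∀ (t₁' : Finset E), (t₁' : Set E) ⊆ K' →
        (∀ x : E, x ∈ K' → (IsIntegral (Algebra.adjoin S (t₁ : Set E)) x ↔
          x ∈ Algebra.adjoin S ((t₁ : Set E) ∪ (t₁' : Set E)))) →
      ∀ (hO' : (Algebra.adjoin S ((t₁ : Set E) ∪ (t₁' : Set E))).toSubring ≤ OE.toSubring),
      ∀ (n : ℕ) (y : E), y ∈ locAtCentre (Algebra.adjoin S ((t₁ : Set E) ∪ (t₁' : Set E))).toSubring OE →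
        ∃ a ∈ locAtCentre (Algebra.adjoin S (t₁ : Set E)).toSubring OE,
        ∃ z : locAtCentre (Algebra.adjoin S ((t₁ : Set E) ∪ (t₁' : Set E))).toSubring OE,
          (haveI := isLocalRing_locAtCentre hO'
           z ∈ maximalIdeal (locAtCentre (Algebra.adjoin S ((t₁ : Set E) ∪ (t₁' : Set E))).toSubring OE) ^ n) ∧
          (z : E) = y - a := by
  classical
  -- the fields `K = M`, `L = N` and the valuation ring `W = O_E ∩ N`
  let K : Type u := M
  let L : Type u := N
  let W : ValuationSubring L := OE.comap (algebraMap L E)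
  have hWmem : ∀ z : L, z ∈ W ↔ (z : E) ∈ OE := fun z => Iff.rfl
  -- Galois approximation: the separating element and its characteristic polynomial
  obtain ⟨a₀, p, hpmon, hpa, hpW, ha₁, haσ⟩ := exists_monic_aeval_eq_zero_coeff_mem K (L := L) W
  let c : Finset E := (p.support).image (fun i => ((p.coeff i : K) : E))
  refine ⟨c, ?_, ?_, ?_⟩
  · intro x hx
    obtain ⟨i, -, rfl⟩ := Finset.mem_image.mp hx
    exact (p.coeff i).2
  · intro x hx
    obtain ⟨i, -, rfl⟩ := Finset.mem_image.mp hx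
    exact (hWmem _).mp (hpW i)
  intro K' hMK' hK'N hK'Z t₁ ht₁M hMcl ht₁O hnorm hct₁ t₁' ht₁'K' hext hO' n y hy
  -- the models
  set B₀ : Subalgebra S E := Algebra.adjoin S (t₁ : Set E) with hB₀def
  set B₀' : Subalgebra S E := Algebra.adjoin S ((t₁ : Set E) ∪ (t₁' : Set E)) with hB₀'def
  have hB₀B₀' : B₀ ≤ B₀' := Algebra.adjoin_mono Set.subset_union_left
  set R₁ : Subring E := locAtCentre B₀.toSubring OE with hR₁def
  set R₁' : Subring E := locAtCentre B₀'.toSubring OE with hR₁'def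
  haveI hR₁loc : IsLocalRing R₁ := isLocalRing_locAtCentre ht₁O
  haveI hR₁'loc : IsLocalRing R₁' := isLocalRing_locAtCentre hO'
  have hR₁O : R₁ ≤ OE.toSubring := locAtCentre_le ht₁O
  have hR₁R₁' : R₁ ≤ R₁' := locAtCentre_mono OE (fun x hx => hB₀B₀' hx)
  -- `B₀ ⊆ M`, fractions
  let MS : Subalgebra S E := { M.toSubring with algebraMap_mem' := fun s => hSM s }
  have hB₀M : B₀ ≤ MS := Algebra.adjoin_le ht₁M
  have hfrac : ∀ z ∈ M, ∃ a ∈ B₀.toSubring, ∃ b ∈ B₀.toSubring, b ≠ 0 ∧ z = a / b := by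
    intro z hz
    obtain ⟨a, b, ha, hb, hb0, hzab⟩ := exists_div_eq_of_mem_closure₁ (t₁ : Set E) (hMcl hz)
    exact ⟨a, ha, b, hb, hb0, hzab⟩
  have hR₁M : ∀ a : R₁, (a : E) ∈ M := by
    rintro ⟨a, y₁, hy₁, z₁, hz₁, -, rfl⟩
    exact M.div_mem (hB₀M hy₁) (hB₀M hz₁)
  -- `A := R₁`, an integrally closed local domain with fraction field `K = M`
  haveI : IsIntegrallyClosed R₁ :=
    isIntegrallyClosed_locAtCentre B₀.toSubring M (fun x hx => hB₀M hx) hfrac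
      (fun x hx hint => hnorm x hx hint) OE ht₁O
  letI : Algebra R₁ K := ((R₁.subtype).codRestrict M hR₁M).toAlgebra
  haveI : IsScalarTower R₁ K E := IsScalarTower.of_algebraMap_eq fun _ => rfl
  have hR₁Kinj : Function.Injective (algebraMap R₁ K) := fun a b hab => by
    apply Subtype.ext
    have := congrArg (fun z : K => (z : E)) hab
    exact this
  haveI : FaithfulSMul R₁ K := (faithfulSMul_iff_algebraMap_injective R₁ K).mpr hR₁Kinj
  haveI : IsFractionRing R₁ K := by
    refine IsFractionRing.of_field R₁ K fun z => ?_
    obtain ⟨a, ha, b, hb, -, hz⟩ := hfrac z z.2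
    exact ⟨⟨a, le_locAtCentre _ _ ha⟩, ⟨b, le_locAtCentre _ _ hb⟩, Subtype.ext hz⟩
  -- `L = N` over `R₁` (through `K`)
  haveI : IsScalarTower R₁ K L := IsScalarTower.of_algebraMap_eq fun _ => rfl
  haveI : IsScalarTower R₁ L E := IsScalarTower.of_algebraMap_eq fun _ => rfl
  -- `C := integral closure of R₁ in L`
  set C : Subalgebra R₁ L := integralClosure R₁ L with hCdef
  haveI : IsFractionRing C L := integralClosure.isFractionRing_of_finite_extension K L
  letI := IsIntegralClosure.MulSemiringAction R₁ K L C
  -- elements of `C` lie in `O_E`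
  letI : Algebra R₁ OE := ((R₁.subtype).codRestrict OE (fun a => hR₁O a.2)).toAlgebra
  haveI : IsScalarTower R₁ OE E := IsScalarTower.of_algebraMap_eq fun _ => rfl
  have hCO : ∀ b : C, (((b : L) : E)) ∈ OE := by
    intro b
    have h1 : IsIntegral R₁ ((b : L) : E) :=
      ((mem_integralClosure_iff R₁ L).mp b.2).map (IsScalarTower.toAlgHom R₁ L E)
    obtain ⟨w, hw⟩ := (IsIntegrallyClosed.isIntegral_iff (R := OE) (K := E)).mp h1.tower_top
    rw [← hw]; exact w.2
  have hCW : ∀ b : C, W.valuation (b : L) ≤ 1 := fun b =>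
    (W.valuation_le_one_iff _).mpr ((hWmem _).mpr (hCO b))
  -- the centre `Q` of `W` on `C`
  let Q : Ideal C :=
    { carrier := {b | W.valuation (b : L) < 1}
      add_mem' := fun {a b} ha hb => by
        change W.valuation (((a + b : C) : L)) < 1
        rw [Subalgebra.coe_add]
        exact lt_of_le_of_lt (Valuation.map_add _ _ _) (max_lt ha hb)
      zero_mem' := by
        change W.valuation (((0 : C) : L)) < 1
        rw [Subalgebra.coe_zero, Valuation.map_zero]; exact zero_lt_one
      smul_mem' := fun c {b} hb => by
        change W.valuation (((c * b : C) : L)) < 1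
        rw [Subalgebra.coe_mul, Valuation.map_mul]
        calc W.valuation (c : L) * W.valuation (b : L) ≤ 1 * W.valuation (b : L) := by
              gcongr; exact hCW c
          _ < 1 := by rw [one_mul]; exact hb }
  have hQ : ∀ b : C, b ∈ Q ↔ W.valuation (algebraMap C L b) < 1 := fun b => Iff.rfl
  haveI hQprime : Q.IsPrime := by
    refine ⟨fun htop => ?_, fun {a b} hab => ?_⟩
    · have h1 : (1 : C) ∈ Q := htop ▸ Submodule.mem_top
      have : W.valuation (((1 : C) : L)) < 1 := h1
      rw [Subalgebra.coe_one, Valuation.map_one] at this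
      exact lt_irrefl _ this
    · have hab' : W.valuation (a : L) * W.valuation (b : L) < 1 := by
        have : W.valuation (((a * b : C) : L)) < 1 := hab
        rwa [Subalgebra.coe_mul, Valuation.map_mul] at this
      by_contra hor
      obtain ⟨hna, hnb⟩ := not_or.mp hor
      have ha : W.valuation (a : L) = 1 := le_antisymm (hCW a) (not_lt.mp hna)
      have hb : W.valuation (b : L) = 1 := le_antisymm (hCW b) (not_lt.mp hnb)
      rw [ha, hb, one_mul] at hab'
      exact lt_irrefl _ hab'
  have hvalE : ∀ z : L, W.valuation z < 1 ↔ OE.valuation (z : E) < 1 :=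
    fun z => valuation_comap_intermediateField_lt_one_iff OE N z
  haveI : Q.LiesOver (maximalIdeal R₁) := by
    refine ⟨le_antisymm (fun a ha => ?_) (fun a ha => ?_)⟩
    · rw [Ideal.under_def, Ideal.mem_comap, hQ, ← IsScalarTower.algebraMap_apply, hvalE]
      exact (mem_maximalIdeal_locAtCentre_iff ht₁O a).mp ha
    · rw [Ideal.under_def, Ideal.mem_comap, hQ, ← IsScalarTower.algebraMap_apply, hvalE] at ha
      exact (mem_maximalIdeal_locAtCentre_iff ht₁O a).mpr ha
  -- the subgroup `H = Gal(N | K′)` and `G_Z ≤ H`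
  let K'' : IntermediateField K L :=
    { carrier := {x : L | (x : E) ∈ K'}
      mul_mem' := fun {a b} ha hb => by
        change (((a * b : L) : E)) ∈ K'
        exact K'.mul_mem ha hb
      one_mem' := by change (((1 : L) : E)) ∈ K'; push_cast; exact K'.one_mem
      add_mem' := fun {a b} ha hb => by
        change (((a + b : L) : E)) ∈ K'
        exact K'.add_mem ha hb
      zero_mem' := by change (((0 : L) : E)) ∈ K'; push_cast; exact K'.zero_mem
      algebraMap_mem' := fun r => hMK' r.2
      inv_mem' := fun x hx => by
        change (((x⁻¹ : L) : E)) ∈ K'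
        exact K'.inv_mem hx }
  have hK''mem : ∀ x : L, x ∈ K'' ↔ (x : E) ∈ K' := fun x => Iff.rfl
  let H : Subgroup (L ≃ₐ[K] L) := K''.fixingSubgroup
  have hGH : MulAction.stabilizer (L ≃ₐ[K] L) W ≤ H := by
    intro σ hσ
    rw [IntermediateField.mem_fixingSubgroup_iff K'' σ]
    intro x hx
    have hσZ : σ ∈ decompositionGroupIn OE N :=
      (mem_decompositionGroupIn_iff_smul_eq OE N σ).mpr hσ
    have hxZ : x ∈ fixedField (decompositionGroupIn OE N) := by
      have h1 : (x : E) ∈ (lift (fixedField (decompositionGroupIn OE N))).toSubfield :=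
        hK'Z ((hK''mem x).mp hx)
      exact (mem_lift x).mp h1
    exact (IntermediateField.mem_fixedField_iff (H := decompositionGroupIn OE N) x).mp hxZ σ hσZ
  -- `R₁` is the ring of invariants; Galois approximation
  haveI : Algebra.IsInvariant R₁ C (L ≃ₐ[K] L) := Algebra.isInvariant_of_isGalois R₁ K L C
  haveI : SMulCommClass (L ≃ₐ[K] L) R₁ C :=
    ⟨fun σ x b => map_smul (galRestrict R₁ K L C σ) x b⟩
  have hcoeff : ∀ i, p.coeff i ∈ (algebraMap R₁ K).range := by
    intro i
    by_cases hi : i ∈ p.support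
    · have hmem : ((p.coeff i : K) : E) ∈ B₀ :=
        hct₁ (Finset.mem_coe.mpr (Finset.mem_image.mpr ⟨i, hi, rfl⟩))
      exact ⟨⟨(p.coeff i : E), le_locAtCentre _ _ hmem⟩, Subtype.ext rfl⟩
    · rw [Polynomial.notMem_support_iff.mp hi]
      exact ⟨0, map_zero _⟩
  have hstab : MulAction.stabilizer (L ≃ₐ[K] L) Q ≤ H :=
    (stabilizer_le_stabilizer_of_coeff_mem_range R₁ K L C W Q hQ hpmon hpa hcoeff ha₁ haσ).trans hGH
  -- `K′` as an `S`-subalgebra; `B₀′ ⊆ K′ ⊆ N`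
  let K'S : Subalgebra S E := { K'.toSubring with algebraMap_mem' := fun s => hMK' (hSM s) }
  have hB₀'K' : B₀' ≤ K'S := Algebra.adjoin_le (Set.union_subset (ht₁M.trans hMK') ht₁'K')
  -- integrality over `B₀` versus over `R₁ = (B₀)_𝔪`
  have hintR₁ : ∀ x : E, x ∈ B₀' → IsIntegral R₁ x := by
    intro x hx
    have h1 : IsIntegral B₀ x := (hext x (hB₀'K' hx)).mpr hx
    have h2 : IsIntegral B₀.toSubring x := h1
    exact h2.tower_top
  -- an element of `L` which is integral over `R₁` and lies in `K′` gives an element of `B^H`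
  set BH := FixedPoints.subalgebra R₁ C H with hBHdef
  have hmkBH : ∀ x : L, (x : E) ∈ K' → IsIntegral R₁ (x : E) →
      ∃ b : BH, (((b : C) : L) : E) = x := by
    intro x hxK' hxint
    have hxL : IsIntegral R₁ x :=
      (isIntegral_algHom_iff (IsScalarTower.toAlgHom R₁ L E) Subtype.val_injective).mp hxint
    let xC : C := ⟨x, (mem_integralClosure_iff R₁ L).mpr hxL⟩
    have hfix : ∀ σ : H, σ • xC = xC := by
      intro σ
      apply Subtype.ext
      change (((σ : L ≃ₐ[K] L) • xC : C) : L) = x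
      rw [show (((σ : L ≃ₐ[K] L) • xC : C) : L) = (σ : L ≃ₐ[K] L) (xC : L) from
        algebraMap_galRestrict_apply R₁ (σ : L ≃ₐ[K] L) xC]
      exact (IntermediateField.mem_fixingSubgroup_iff K'' (σ : L ≃ₐ[K] L)).mp σ.2 x
        ((hK''mem x).mpr hxK')
    exact ⟨⟨xC, hfix⟩, rfl⟩
  -- conversely, elements of `B^H` lie in `K′` and in `R₁′`
  have hBHK' : ∀ b : BH, (((b : C) : L) : E) ∈ K' := by
    intro b
    have h1 : ((b : C) : L) ∈ fixedField H := by
      rw [IntermediateField.mem_fixedField_iff]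
      intro σ hσ
      have h2 : (((⟨σ, hσ⟩ : H) • (b : C) : C) : L) = ((b : C) : L) :=
        congrArg (fun z : C => (z : L)) (b.2 ⟨σ, hσ⟩)
      rwa [show (((⟨σ, hσ⟩ : H) • (b : C) : C) : L) = σ ((b : C) : L) from
        algebraMap_galRestrict_apply R₁ σ (b : C)] at h2
    rw [IsGalois.fixedField_fixingSubgroup K''] at h1
    exact (hK''mem _).mp h1
  have hBHR₁' : ∀ b : BH, (((b : C) : L) : E) ∈ R₁' := by
    intro b
    have hint : IsIntegral R₁ (((b : C) : L) : E) :=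
      ((mem_integralClosure_iff R₁ L).mp (b : C).2).map (IsScalarTower.toAlgHom R₁ L E)
    obtain ⟨⟨m, hm⟩, hmint⟩ := IsIntegral.exists_multiple_integral_of_isLocalization
      (subringCentre B₀.toSubring OE ht₁O).primeCompl (((b : C) : L) : E) hint
    have hvm : OE.valuation ((m : E)) = 1 := valuation_eq_one_of_not_mem_subringCentre ht₁O hm
    have hm0 : (m : E) ≠ 0 := ne_zero_of_valuation_eq_one hvm
    have hx : (m : E) * (((b : C) : L) : E) ∈ B₀' := by
      have h1 : IsIntegral B₀ ((m : E) * (((b : C) : L) : E)) := hmint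
      refine (hext _ ?_).mp h1
      exact K'.mul_mem (hMK' (hB₀M m.2)) (hBHK' b)
    rw [mem_locAtCentre_iff]
    exact ⟨_, hx, (m : E), hB₀B₀' m.2, hvm, by field_simp⟩
  -- the ring map `B^H → R₁′` and the localization structure
  let φ₀ : BH →+* E := (algebraMap L E).comp ((C.val.toRingHom).comp BH.val.toRingHom)
  have hφ₀ : ∀ b : BH, φ₀ b = (((b : C) : L) : E) := fun _ => rfl
  let φ : BH →+* R₁' := φ₀.codRestrict R₁' (fun b => by rw [hφ₀]; exact hBHR₁' b)
  have hφ : ∀ b : BH, ((φ b : R₁') : E) = (((b : C) : L) : E) := fun _ => rfl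
  have hφinj : Function.Injective φ := by
    intro a b hab
    have h1 : (((a : C) : L) : E) = (((b : C) : L) : E) := congrArg (fun z : R₁' => (z : E)) hab
    exact Subtype.ext (Subtype.ext (Subtype.ext h1))
  letI : Algebra BH R₁' := φ.toAlgebra
  have hQ' : ∀ b : BH, b ∈ Q.under BH ↔ OE.valuation (((b : C) : L) : E) < 1 := fun b => by
    rw [Ideal.under_def, Ideal.mem_comap, hQ, ← hvalE]; rfl
  haveI : IsLocalization.AtPrime R₁' (Q.under BH) :=
    { map_units := fun y => by
        have hv : OE.valuation ((((y : BH) : C) : L) : E) = 1 := by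
          refine le_antisymm ((OE.valuation_le_one_iff _).mpr (hCO _)) (not_lt.mp ?_)
          exact fun hlt => y.2 ((hQ' _).mpr hlt)
        have h0 := ne_zero_of_valuation_eq_one hv
        refine ⟨⟨algebraMap BH R₁' (y : BH), ⟨((((y : BH) : C) : L) : E)⁻¹,
          inv_mem_locAtCentre (hBHR₁' _) hv⟩, Subtype.ext ?_, Subtype.ext ?_⟩, rfl⟩
        · change ((((y : BH) : C) : L) : E) * ((((y : BH) : C) : L) : E)⁻¹ = 1
          exact mul_inv_cancel₀ h0
        · change ((((y : BH) : C) : L) : E)⁻¹ * ((((y : BH) : C) : L) : E) = 1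
          exact inv_mul_cancel₀ h0
      surj := fun w => by
        obtain ⟨α, hα, β, hβ, hvβ, hw⟩ := w.2
        have hαK' : α ∈ K' := hB₀'K' hα
        have hβK' : β ∈ K' := hB₀'K' hβ
        obtain ⟨bα, hbα⟩ := hmkBH ⟨α, hK'N hαK'⟩ hαK' (hintR₁ α hα)
        obtain ⟨bβ, hbβ⟩ := hmkBH ⟨β, hK'N hβK'⟩ hβK' (hintR₁ β hβ)
        have hbβQ : bβ ∈ (Q.under BH).primeCompl := by
          intro hmem
          have h1 : OE.valuation (((bβ : C) : L) : E) < 1 := (hQ' bβ).mp hmem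
          rw [hbβ, hvβ] at h1
          exact lt_irrefl _ h1
        refine ⟨(bα, ⟨bβ, hbβQ⟩), Subtype.ext ?_⟩
        change (w : E) * (((bβ : C) : L) : E) = (((bα : C) : L) : E)
        rw [hbα, hbβ, hw, div_mul_cancel₀ _ (ne_zero_of_valuation_eq_one hvβ)]
      exists_of_eq := fun {a b} hab => ⟨1, by rw [hφinj hab]⟩ }
  -- density
  have hsurj := surjective_quotient_maximalIdeal_pow_comp_of_stabilizer_le (A := R₁) (B := C)
    H Q hstab R₁' n
  rcases hsurj (Ideal.Quotient.mk _ ⟨y, hy⟩) with ⟨a, ha⟩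
  refine ⟨((a : R₁) : E), a.2, ⟨y, hy⟩ - φ (algebraMap R₁ BH a), ?_, ?_⟩
  · rw [← Ideal.Quotient.eq]
    exact ha.symm
  · change y - ((φ (algebraMap R₁ BH a) : R₁') : E) = y - ((a : R₁) : E)
    rw [hφ]
    rfl

end Literature.AlgebraicGeometry.Resolution


/-! ## The two hypotheses of `DenseRegularDescent.isRegularLocalRing_of_dense` in the frame -/

namespace Literature.AlgebraicGeometry.Resolution

universe v

/-- **Unramified from dense (Nakayama).** A ring map `f : A → B` of local rings, `B` Noetherian,
with `f(𝔪_A) ⊆ 𝔪_B`, `f⁻¹(𝔪_B) ⊆ 𝔪_A` and `B = f(A) + 𝔪_B²`, satisfies `𝔪_A B = 𝔪_B`.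
[cite: CossartPiltant2008, proof of Prop. 9.3 (HAL p. 28), "`R₁` lies dense in `R₁′`"] -/
theorem map_maximalIdeal_eq_of_dense {A B : Type*} [CommRing A] [CommRing B] [IsLocalRing A]
    [IsLocalRing B] [IsNoetherianRing B] (f : A →+* B)
    (hle : (maximalIdeal A).map f ≤ maximalIdeal B)
    (hloc : ∀ a : A, f a ∈ maximalIdeal B → a ∈ maximalIdeal A)
    (hd : ∀ b : B, ∃ a : A, b - f a ∈ maximalIdeal B ^ 2) :
    (maximalIdeal A).map f = maximalIdeal B := by
  refine le_antisymm hle ?_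
  have hfg : (maximalIdeal B).FG := (isNoetherianRing_iff_ideal_fg B).mp inferInstance _
  refine Submodule.le_of_le_smul_of_le_jacobson_bot hfg
    (IsLocalRing.maximalIdeal_le_jacobson ⊥) (fun y hy => ?_)
  obtain ⟨a, ha⟩ := hd y
  have hfa : f a ∈ maximalIdeal B := by
    have : f a = y - (y - f a) := by ring
    rw [this]
    exact Ideal.sub_mem _ hy (Ideal.pow_le_self two_ne_zero ha)
  have haA : a ∈ maximalIdeal A := hloc a hfa
  have : y = f a + (y - f a) := by ring
  rw [this]
  refine Submodule.add_mem_sup (Ideal.mem_map_of_mem f haA) ?_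
  rw [Ideal.smul_eq_mul, ← pow_two]
  exact ha

set_option maxHeartbeats 400000 in
/-- **[CoP1] Prop. 9.3, decomposition layer, frame form of "`R₁ → R₁′` is unramified with trivial
residue extension".** Same data as `exists_finset_dense_locAtCentre`; conclusion: for the
inclusion `ι : R₁ → R₁′` of the local rings, `𝔪_{R₁} R₁′ = 𝔪_{R₁′}` and every element of `R₁′`
is congruent to an element of `R₁` modulo `𝔪_{R₁′}` — exactly the hypotheses `hm`, `hres` of
`isRegularLocalRing_of_dense` (`DenseRegularDescent.lean`) and of
`surjective_quotient_maximalIdeal_pow_comp` (`UnramifiedLocalHomDense.lean`).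
[cite: CossartPiltant2008, proof of Prop. 9.3 (HAL pp. 27–28)] [cite: Abhyankar1959, Thm. 1.47] -/
theorem exists_finset_unramified_locAtCentre
    (S : Type v) [CommRing S] [IsNoetherianRing S]
    (E : Type v) [Field E] [Algebra S E]
    (OE : ValuationSubring E)
    (M : Subfield E) (hSM : ∀ s : S, algebraMap S E s ∈ M)
    (N : IntermediateField M E) [FiniteDimensional M N] [IsGalois M N] :
    ∃ c : Finset E, (c : Set E) ⊆ (M : Set E) ∧ (∀ x ∈ c, x ∈ OE) ∧
      ∀ (K' : Subfield E), M ≤ K' → K' ≤ N.toSubfield →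
        K' ≤ (lift (fixedField (decompositionGroupIn OE N))).toSubfield →
      ∀ (t₁ : Finset E), (t₁ : Set E) ⊆ M →
        M ≤ Subfield.closure (Set.range (algebraMap S E) ∪ (t₁ : Set E)) →
      ∀ (ht₁O : (Algebra.adjoin S (t₁ : Set E)).toSubring ≤ OE.toSubring),
        (∀ x : E, x ∈ M → IsIntegral (Algebra.adjoin S (t₁ : Set E)) x →
          x ∈ Algebra.adjoin S (t₁ : Set E)) →
        (c : Set E) ⊆ Algebra.adjoin S (t₁ : Set E) →
      ∀ (t₁' : Finset E), (t₁' : Set E) ⊆ K' →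
        (∀ x : E, x ∈ K' → (IsIntegral (Algebra.adjoin S (t₁ : Set E)) x ↔
          x ∈ Algebra.adjoin S ((t₁ : Set E) ∪ (t₁' : Set E)))) →
      ∀ (hO' : (Algebra.adjoin S ((t₁ : Set E) ∪ (t₁' : Set E))).toSubring ≤ OE.toSubring),
      ∃ hle : locAtCentre (Algebra.adjoin S (t₁ : Set E)).toSubring OE ≤
          locAtCentre (Algebra.adjoin S ((t₁ : Set E) ∪ (t₁' : Set E))).toSubring OE,
        (haveI := isLocalRing_locAtCentre ht₁O
         haveI := isLocalRing_locAtCentre hO'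
         (maximalIdeal (locAtCentre (Algebra.adjoin S (t₁ : Set E)).toSubring OE)).map
            (Subring.inclusion hle) =
          maximalIdeal (locAtCentre (Algebra.adjoin S ((t₁ : Set E) ∪ (t₁' : Set E))).toSubring OE)) ∧
        ∀ b : locAtCentre (Algebra.adjoin S ((t₁ : Set E) ∪ (t₁' : Set E))).toSubring OE,
          ∃ a : locAtCentre (Algebra.adjoin S (t₁ : Set E)).toSubring OE,
            (haveI := isLocalRing_locAtCentre hO'
             b - Subring.inclusion hle a ∈
              maximalIdeal (locAtCentre (Algebra.adjoin S ((t₁ : Set E) ∪ (t₁' : Set E))).toSubring OE)) := by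
  classical
  obtain ⟨c, hcM, hcO, hdense⟩ := exists_finset_dense_locAtCentre S E OE M hSM N
  refine ⟨c, hcM, hcO, ?_⟩
  intro K' hMK' hK'N hK'Z t₁ ht₁M hMcl ht₁O hnorm hct₁ t₁' ht₁'K' hext hO'
  have hd := hdense K' hMK' hK'N hK'Z t₁ ht₁M hMcl ht₁O hnorm hct₁ t₁' ht₁'K' hext hO'
  set B₀ : Subalgebra S E := Algebra.adjoin S (t₁ : Set E) with hB₀def
  set B₀' : Subalgebra S E := Algebra.adjoin S ((t₁ : Set E) ∪ (t₁' : Set E)) with hB₀'def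
  have hB₀B₀' : B₀ ≤ B₀' := Algebra.adjoin_mono Set.subset_union_left
  have hle : locAtCentre B₀.toSubring OE ≤ locAtCentre B₀'.toSubring OE :=
    locAtCentre_mono OE (fun x hx => hB₀B₀' hx)
  haveI hR₁loc : IsLocalRing (locAtCentre B₀.toSubring OE) := isLocalRing_locAtCentre ht₁O
  haveI hR₁'loc : IsLocalRing (locAtCentre B₀'.toSubring OE) := isLocalRing_locAtCentre hO'
  -- `R₁′` is Noetherian: a localization of the finitely generated `S`-algebra `S[t₁ ∪ t₁′]`
  haveI : Algebra.FiniteType S B₀' := by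
    rw [hB₀'def, ← Finset.coe_union]
    exact (Subalgebra.fg_iff_finiteType _).mp (Subalgebra.fg_adjoin_finset _)
  haveI : IsNoetherianRing B₀' := Algebra.FiniteType.isNoetherianRing S B₀'
  let eB : B₀' ≃+* B₀'.toSubring :=
    { toFun := fun x => ⟨x.1, x.2⟩
      invFun := fun x => ⟨x.1, x.2⟩
      left_inv := fun _ => rfl
      right_inv := fun _ => rfl
      map_mul' := fun _ _ => rfl
      map_add' := fun _ _ => rfl }
  haveI : IsNoetherianRing B₀'.toSubring := isNoetherianRing_of_ringEquiv B₀' eB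
  haveI : IsNoetherianRing (locAtCentre B₀'.toSubring OE) :=
    IsLocalization.isNoetherianRing (subringCentre B₀'.toSubring OE hO').primeCompl _
      inferInstance
  refine ⟨hle, ?_, ?_⟩
  · refine map_maximalIdeal_eq_of_dense (Subring.inclusion hle) ?_ ?_ ?_
    · rw [Ideal.map_le_iff_le_comap]
      intro a ha
      rw [Ideal.mem_comap, mem_maximalIdeal_locAtCentre_iff hO']
      exact (mem_maximalIdeal_locAtCentre_iff ht₁O a).mp ha
    · intro a ha
      rw [mem_maximalIdeal_locAtCentre_iff hO'] at ha
      exact (mem_maximalIdeal_locAtCentre_iff ht₁O a).mpr ha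
    · intro b
      obtain ⟨a, haR₁, z, hz, hzE⟩ := hd 2 (b : E) b.2
      refine ⟨⟨a, haR₁⟩, ?_⟩
      have : b - Subring.inclusion hle ⟨a, haR₁⟩ = z := Subtype.ext (by rw [hzE]; rfl)
      rw [this]
      exact hz
  · intro b
    obtain ⟨a, haR₁, z, hz, hzE⟩ := hd 1 (b : E) b.2
    refine ⟨⟨a, haR₁⟩, ?_⟩
    have : b - Subring.inclusion hle ⟨a, haR₁⟩ = z := Subtype.ext (by rw [hzE]; rfl)
    rw [this, ← pow_one (maximalIdeal _)]
    exact hz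

end Literature.AlgebraicGeometry.Resolution

end
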